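import Summits.NavierStokesRegularity.FluidComputer.LeraySupClock
import Mathlib.Analysis.SpecialFunctions.NonIntegrable
import HarnessLib

/-!
# Fluid computer — the level dictionary, SERRIN FACE (L30): every Prodi–Serrin integral diverges on every
# terminal window; the blow-up is at least Type I

HONEST FRAMING (cell `pub-fluidc`, verbatim): *low prior, high value-of-information experiment on Tao's
machine paradigm; NOT a claim that NS blows up.* Theorem side of the cell; nothing here is evidence of blow-up.
The time face (L21/L21′, `LeraySupClock`) gives Leray's rates `c√ν/√(T − t) ≤ ‖u(t)‖_∞` and
`c_r ν^{(r+3)/(2r)} (T − t)^{−(r−3)/(2r)} ≤ ‖u(t)‖_{L^r}` (`3 < r < ∞`) at every instant. Integrated in time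
they are the classical Prodi–Serrin–Ladyzhenskaya blow-up criteria read as NECESSITIES — the diagnostics a DNS
reads off its `u_max(t)` curve. For every maximal smooth solution `(u, p)` of the unforced Navier–Stokes system
on `ℝ³ × [0, T)` (`ν > 0`) which is Leray–Hopf from `u 0`, and every `t₀ ∈ [0, T)`:

* `lintegral_inv_sub_eq_top` — `∫_{t₀}^T (T − s)⁻¹ ds = ∞` (bookkeeping: `(x − T)⁻¹` is not integrable at `T`,
  Mathlib's `intervalIntegrable_sub_inv_iff`);
* `lintegral_supNorm_sq_eq_top` (**L30 — THE SERRIN FACE, `r = ∞`**): `∫_{t₀}^T ‖u(s)‖_∞² ds = ∞` — the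
  running integral of the squared maximum speed diverges (at least like `c²ν log((T − t₀)/(T − t))`);
* `lintegral_Lr_serrin_eq_top` (**L30′, `3 < r < ∞`**): `∫_{t₀}^T ‖u(s)‖_{L^r}^{2r/(r−3)} ds = ∞` — the velocity
  leaves EVERY Serrin class `L^q_t L^r_x`, `2/q + 3/r = 1`, on every terminal window;
* `not_subTypeI_rate` (**L30″ — AT LEAST TYPE I**): no bound `‖u(t)‖_∞ ≤ C (T − t)^{−γ}` with `γ < 1/2` holds on a
  terminal window — Leray's exponent `1/2` is the floor of the amplitude rate.

In the tree the same conclusions exist for Fefferman's class (`ClayBlowupSerrin`, forced, rapidly decaying data,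
via the Serrin–Grönwall enstrophy inequality); here they are derived for the dictionary's class (finite energy,
no decay, no symmetry) directly from the clocks, hence on every terminal window `(t₀, T)` and with the same
absolute constants as L21/L21′. HONEST SIZE NOTE: constants inexplicit; the statements are in FORM checkable
against a measured `u_max(t)` curve ('∫ u_max² dt keeps growing without bound; u_max(T − t)^{1/2} does not tend
to zero'), their numbers are not. Necessity only. 0 sorry; no new definitions, no named facts.

## References

* J. Serrin, in *Nonlinear Problems* (Univ. Wisconsin Press, 1963), Thm. 6; G. Prodi, Ann. Mat. Pura Appl. 48
  (1959) 173–182. [Prodi1959]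
* J. Leray, Acta Math. 63 (1934) 193–248, §19 (3.8)–(3.9), §22. [Leray1934]
* H. Sohr, *The Navier–Stokes Equations*, Birkhäuser 2001, Thm. V.1.8.1. [Sohr2001]
* P. G. Lemarié-Rieusset, *The Navier–Stokes Problem in the 21st Century*, CRC 2016, Thm. 11.2, Thm. 11.4.
  [LemarieRieusset2016]
-/

noncomputable section

open MeasureTheory Set Function Filter Topology Metric
open scoped ENNReal NNReal
open Literature.Analysis.FluidPDE Literature.Analysis.FunctionSpaces
open Summit.NavierStokesRegularity.FluidComputer.LeraySupClock

namespace Summit.NavierStokesRegularity.FluidComputer.SerrinFace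

/-! ## Bookkeeping: `∫_{t₀}^T (T − s)⁻¹ ds = ∞` -/

/-- **`(T − s)⁻¹` is not integrable at `T`**: for `t₀ < T`, `∫⁻_{(t₀, T)} (T − s)⁻¹ ds = ∞` (Mathlib's
`intervalIntegrable_sub_inv_iff`: `(x − T)⁻¹` is interval integrable on `[t₀, T]` only if `t₀ = T`). [folklore] -/
theorem lintegral_inv_sub_eq_top {t₀ T : ℝ} (h : t₀ < T) :
    ∫⁻ s in Ioo t₀ T, ENNReal.ofReal ((T - s)⁻¹) = ∞ := by
  -- `(x - T)⁻¹` is not interval integrable on `[t₀, T]`, hence neither is `(T - x)⁻¹ = -(x - T)⁻¹`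
  have hni : ¬ IntervalIntegrable (fun x : ℝ => (x - T)⁻¹) volume t₀ T := by
    rw [intervalIntegrable_sub_inv_iff, not_or]
    exact ⟨h.ne, fun hc => hc right_mem_uIcc⟩
  have hni' : ¬ IntervalIntegrable (fun x : ℝ => (T - x)⁻¹) volume t₀ T := by
    intro hI
    refine hni ?_
    have hneg := hI.neg
    refine hneg.congr fun x _ => ?_
    show -((T - x)⁻¹) = (x - T)⁻¹
    rw [← inv_neg, neg_sub]
  rw [intervalIntegrable_iff, uIoc_of_le h.le] at hni'
  -- not integrable and measurable: the `enorm` integral is infinite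
  have hmeas : AEStronglyMeasurable (fun x : ℝ => (T - x)⁻¹) (volume.restrict (Ioc t₀ T)) :=
    ((measurable_const.sub measurable_id).inv).aestronglyMeasurable
  have htop : ∫⁻ x in Ioc t₀ T, ‖(T - x)⁻¹‖ₑ = ∞ := by
    by_contra hne
    exact hni' ⟨hmeas, lt_top_iff_ne_top.2 hne⟩
  -- `‖(T - x)⁻¹‖ₑ = ofReal ((T - x)⁻¹)` on `(t₀, T]`, and `(t₀, T) = (t₀, T]` a.e.
  rw [setLIntegral_congr Ioo_ae_eq_Ioc, ← htop]
  refine setLIntegral_congr_fun measurableSet_Ioc fun x hx => ?_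
  rw [Real.enorm_eq_ofReal (inv_nonneg.2 (sub_nonneg.2 hx.2))]

/-! ## L30: the Serrin face -/

/-- **L30 — THE SERRIN FACE (`r = ∞`): the squared maximum speed is not integrable up to the lifespan.** Along
every maximal smooth Leray–Hopf solution of the unforced Navier–Stokes system on `ℝ³ × [0, T)` (`ν > 0`), for
every `t₀ ∈ [0, T)`: `∫⁻_{(t₀, T)} ‖u(s)‖_{L^∞}² ds = ∞` — the Prodi–Serrin class `L²_t L^∞_x` is left on every
terminal window. From Leray's sup clock `c√ν/√(T − s) ≤ ‖u(s)‖_∞` (L21, `LeraySupClock.supNorm_clock`):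
`‖u(s)‖_∞² ≥ c²ν (T − s)⁻¹`, and `(T − s)⁻¹` is not integrable at `T`. [cite: Prodi1959]
[cite: Leray1934, §19 (3.8)–(3.9) p. 224] [cite: Sohr2001, Thm. V.1.8.1] -/
theorem lintegral_supNorm_sq_eq_top {ν T : ℝ} (hν : 0 < ν) (hT : 0 < T)
    {u : ℝ → EuclideanSpace ℝ (Fin 3) → EuclideanSpace ℝ (Fin 3)} {p : ℝ → EuclideanSpace ℝ (Fin 3) → ℝ}
    (hmax : IsMaximalSmoothSolution ν 0 u p T) (hLH : IsLerayHopfOn T ν 0 (u 0) u)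
    {t₀ : ℝ} (ht₀ : t₀ ∈ Ico 0 T) :
    ∫⁻ s in Ioo t₀ T, eLpNorm (u s) ∞ volume ^ 2 = ∞ := by
  obtain ⟨c, hc, H⟩ := supNorm_clock
  have hc2 : 0 < c ^ 2 * ν := by positivity
  -- pointwise: `ofReal (c²ν) · ofReal ((T - s)⁻¹) ≤ ‖u(s)‖_∞²`
  have hpt : ∀ s ∈ Ioo t₀ T,
      ENNReal.ofReal (c ^ 2 * ν) * ENNReal.ofReal ((T - s)⁻¹) ≤ eLpNorm (u s) ∞ volume ^ 2 := by
    intro s hs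
    have hsT : 0 < T - s := sub_pos.2 hs.2
    have h := H ν T hν hT u p hmax hLH s ⟨ht₀.1.trans_lt hs.1, hs.2⟩
    have h2 := pow_le_pow_left' h 2
    refine le_trans (le_of_eq ?_) h2
    rw [← ENNReal.ofReal_mul hc2.le, ← ENNReal.ofReal_pow (by positivity)]
    congr 1
    rw [div_pow, mul_pow, Real.sq_sqrt hν.le, Real.sq_sqrt hsT.le, div_eq_mul_inv]
  refine eq_top_iff.2 ?_
  calc (⊤ : ℝ≥0∞) = ENNReal.ofReal (c ^ 2 * ν) * ∫⁻ s in Ioo t₀ T, ENNReal.ofReal ((T - s)⁻¹) := by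
        rw [lintegral_inv_sub_eq_top ht₀.2, ENNReal.mul_top (ENNReal.ofReal_pos.2 hc2).ne']
    _ = ∫⁻ s in Ioo t₀ T, ENNReal.ofReal (c ^ 2 * ν) * ENNReal.ofReal ((T - s)⁻¹) :=
        (lintegral_const_mul' _ _ ENNReal.ofReal_ne_top).symm
    _ ≤ ∫⁻ s in Ioo t₀ T, eLpNorm (u s) ∞ volume ^ 2 := setLIntegral_mono' measurableSet_Ioo hpt

/-- **L30′ — THE SERRIN FACE (`3 < r < ∞`): the velocity leaves every Serrin class on every terminal window.**
Along every maximal smooth Leray–Hopf solution of the unforced system (`ν > 0`), for every `3 < r < ∞` and every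
`t₀ ∈ [0, T)`: `∫⁻_{(t₀, T)} ‖u(s)‖_{L^r}^{2r/(r−3)} ds = ∞` (`2/q + 3/r = 1` with `q = 2r/(r − 3)`). From Leray's
`L^r` clock (L21′, `LeraySupClock.Lr_clock`): `‖u(s)‖_r^{2r/(r−3)} ≥ c^{2r/(r−3)} ν^{(r+3)/(r−3)} (T − s)⁻¹`.
[cite: Prodi1959] [cite: Leray1934, §22 p. 227] [cite: LemarieRieusset2016, Thm. 11.2] -/
theorem lintegral_Lr_serrin_eq_top {ν T : ℝ} (hν : 0 < ν) (hT : 0 < T)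
    {u : ℝ → EuclideanSpace ℝ (Fin 3) → EuclideanSpace ℝ (Fin 3)} {p : ℝ → EuclideanSpace ℝ (Fin 3) → ℝ}
    (hmax : IsMaximalSmoothSolution ν 0 u p T) (hLH : IsLerayHopfOn T ν 0 (u 0) u)
    (r : ℝ) (hr : 3 < r) {t₀ : ℝ} (ht₀ : t₀ ∈ Ico 0 T) :
    ∫⁻ s in Ioo t₀ T, eLpNorm (u s) (ENNReal.ofReal r) volume ^ (2 * r / (r - 3)) = ∞ := by
  obtain ⟨c, hc, H⟩ := Lr_clock r hr
  have hr0 : 0 < r := by linarith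
  have hr3 : 0 < r - 3 := by linarith
  set q : ℝ := 2 * r / (r - 3) with hq
  have hq0 : 0 < q := by positivity
  -- the constant `K = c^q ν^{(r+3)/(r-3)}`
  set K : ℝ := c ^ q * ν ^ ((r + 3) / (r - 3)) with hK
  have hK0 : 0 < K := by positivity
  -- pointwise: `ofReal K · ofReal ((T - s)⁻¹) ≤ ‖u(s)‖_r ^ q`
  have hpt : ∀ s ∈ Ioo t₀ T,
      ENNReal.ofReal K * ENNReal.ofReal ((T - s)⁻¹) ≤ eLpNorm (u s) (ENNReal.ofReal r) volume ^ q := by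
    intro s hs
    have hsT : 0 < T - s := sub_pos.2 hs.2
    have h := H ν T hν hT u p hmax hLH s ⟨ht₀.1.trans_lt hs.1, hs.2⟩
    have h2 := ENNReal.rpow_le_rpow h hq0.le
    refine le_trans (le_of_eq ?_) h2
    have hbase : 0 ≤ c * ν ^ ((r + 3) / (2 * r)) * (T - s) ^ (-((r - 3) / (2 * r))) := by positivity
    rw [← ENNReal.ofReal_mul hK0.le, ENNReal.ofReal_rpow_of_nonneg hbase hq0.le]
    congr 1
    rw [Real.mul_rpow (by positivity) (Real.rpow_nonneg hsT.le _),
      Real.mul_rpow hc.le (Real.rpow_nonneg hν.le _), ← Real.rpow_mul hν.le, ← Real.rpow_mul hsT.le]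
    have hr0' : r ≠ 0 := hr0.ne'
    have hr3' : r - 3 ≠ 0 := hr3.ne'
    have e1 : (r + 3) / (2 * r) * q = (r + 3) / (r - 3) := by
      rw [hq]
      field_simp
    have e2 : -((r - 3) / (2 * r)) * q = -1 := by
      rw [hq]
      field_simp
    rw [e1, e2, Real.rpow_neg_one]
  refine eq_top_iff.2 ?_
  calc (⊤ : ℝ≥0∞) = ENNReal.ofReal K * ∫⁻ s in Ioo t₀ T, ENNReal.ofReal ((T - s)⁻¹) := by
        rw [lintegral_inv_sub_eq_top ht₀.2, ENNReal.mul_top (ENNReal.ofReal_pos.2 hK0).ne']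
    _ = ∫⁻ s in Ioo t₀ T, ENNReal.ofReal K * ENNReal.ofReal ((T - s)⁻¹) :=
        (lintegral_const_mul' _ _ ENNReal.ofReal_ne_top).symm
    _ ≤ ∫⁻ s in Ioo t₀ T, eLpNorm (u s) (ENNReal.ofReal r) volume ^ q := setLIntegral_mono' measurableSet_Ioo hpt

/-! ## L30″: at least Type I -/

/-- **L30″ — THE BLOW-UP IS AT LEAST TYPE I.** Along every maximal smooth Leray–Hopf solution of the unforced
system (`ν > 0`): for no `C ≥ 0`, `γ < 1/2` and `t₀ < T` does `‖u(t)‖_∞ ≤ C (T − t)^{−γ}` hold for all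
`t ∈ (t₀, T)` — Leray's exponent `1/2` is the floor of the amplitude rate (any slower algebraic growth of the
maximum speed excludes blow-up at `T`). From the sup clock: `c√ν (T − t)^{−1/2} ≤ C (T − t)^{−γ}` fails for
`T − t` small. [cite: Leray1934, §19 (3.8)–(3.9) p. 224] [cite: LemarieRieusset2016, Thm. 11.4] -/
theorem not_subTypeI_rate {ν T : ℝ} (hν : 0 < ν) (hT : 0 < T)
    {u : ℝ → EuclideanSpace ℝ (Fin 3) → EuclideanSpace ℝ (Fin 3)} {p : ℝ → EuclideanSpace ℝ (Fin 3) → ℝ}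
    (hmax : IsMaximalSmoothSolution ν 0 u p T) (hLH : IsLerayHopfOn T ν 0 (u 0) u)
    {C γ t₀ : ℝ} (hC : 0 ≤ C) (hγ : γ < 1 / 2) (ht₀ : t₀ ∈ Ico 0 T)
    (hrate : ∀ t ∈ Ioo t₀ T, eLpNorm (u t) ∞ volume ≤ ENNReal.ofReal (C * (T - t) ^ (-γ))) : False := by
  obtain ⟨c, hc, H⟩ := supNorm_clock
  have hcν : 0 < c * Real.sqrt ν := mul_pos hc (Real.sqrt_pos.2 hν)
  -- choose `t ∈ (t₀, T)` with `(T - t)^{1/2 - γ} < c√ν / (C + 1)`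
  have hexp : 0 < 1 / 2 - γ := by linarith
  set ε : ℝ := c * Real.sqrt ν / (C + 1) with hε
  have hε0 : 0 < ε := div_pos hcν (by linarith)
  -- `d = min ((ε/2)^{1/(1/2-γ)}) ((T - t₀)/2)`, `t = T - d`
  set d : ℝ := min ((ε / 2) ^ (1 / (1 / 2 - γ))) ((T - t₀) / 2) with hd
  have hd0 : 0 < d := lt_min (Real.rpow_pos_of_pos (by positivity) _) (by linarith [ht₀.2])
  have hdT : d ≤ (T - t₀) / 2 := min_le_right _ _
  have hdε : d ^ (1 / 2 - γ) ≤ ε / 2 := by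
    have h1 : d ≤ (ε / 2) ^ (1 / (1 / 2 - γ)) := min_le_left _ _
    calc d ^ (1 / 2 - γ) ≤ ((ε / 2) ^ (1 / (1 / 2 - γ))) ^ (1 / 2 - γ) :=
          Real.rpow_le_rpow hd0.le h1 hexp.le
      _ = ε / 2 := by
          rw [← Real.rpow_mul (by positivity), one_div_mul_cancel hexp.ne', Real.rpow_one]
  set t : ℝ := T - d with htdef
  have ht : t ∈ Ioo t₀ T := ⟨by rw [htdef]; linarith, by rw [htdef]; linarith⟩
  have hTt : T - t = d := by rw [htdef]; ring
  -- the clock at `t` against the hypothesised rate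
  have hlow := H ν T hν hT u p hmax hLH t ⟨ht₀.1.trans_lt ht.1, ht.2⟩
  have hup := hrate t ht
  have hle : c * Real.sqrt ν / Real.sqrt (T - t) ≤ C * (T - t) ^ (-γ) := by
    have := hlow.trans hup
    rwa [ENNReal.ofReal_le_ofReal_iff (mul_nonneg hC (Real.rpow_nonneg (sub_pos.2 ht.2).le _))] at this
  -- i.e. `c√ν ≤ C d^{1/2 - γ} ≤ C ε/2 < (C+1) ε = c√ν`: contradiction
  rw [hTt] at hle
  have hsqrt : Real.sqrt d = d ^ (1 / 2 : ℝ) := Real.sqrt_eq_rpow d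
  have hmul : c * Real.sqrt ν ≤ C * d ^ (1 / 2 - γ) := by
    rw [div_le_iff₀ (Real.sqrt_pos.2 hd0), hsqrt, mul_assoc, ← Real.rpow_add hd0] at hle
    have e : -γ + 1 / 2 = 1 / 2 - γ := by ring
    rwa [e] at hle
  have hfin : c * Real.sqrt ν ≤ C * (ε / 2) := hmul.trans (mul_le_mul_of_nonneg_left hdε hC)
  have hεeq : (C + 1) * ε = c * Real.sqrt ν := by
    rw [hε]; field_simp
  nlinarith [hfin, hεeq, hε0, hC]

end Summit.NavierStokesRegularity.FluidComputer.SerrinFace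

end
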